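import Summits.NavierStokesRegularity.NavierStokesRegularity.Theses.AxisymmetricExtremality
import Summits.NavierStokesRegularity.NavierStokesRegularity.Theorems.AxisymmetricExtremalityAxisymmetricKatoGlobalStubSeregin2020TypeIILemma22AxisTerm
import HarnessLib

/-!
# Seregin 2020, Lemma 2.2 (after Nazarov–Uraltseva 2012): the axis term in space–time,
# `∫∫ F (2x'/|x'|²)·∇ψ_ε dx dt → 4π ∫∫ F(t, 0, 0, x₃) dx₃ dt`

Helper toward the stub `stub_seregin2020TypeII` of the crux `AxisymmetricKatoGlobal` (= the named
fact `Literature.Analysis.FluidPDE.Seregin2020_axisymmetricSingularPoint_typeII`, G. Seregin,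
Anal. Math. Phys. 10 (2020) Paper 46 = arXiv:2006.04140, Thm 2.1; remaining ingredient Lemma 2.2
in the corrected rendering `hWH′`). The sibling `…Lemma22AxisTerm` computes, slice by slice in
time, the limit `∫ F(x) (2/ϱ)∂_ϱψ_ε(x) dx → 2c₂ ∫ F(0,0,x₃) dx₃` producing the axis term
`4π₀ ∫ πη dx₃dt` of Seregin's displayed inequality (arXiv p. 8) / Nazarov–Uraltseva's (4.5).
This file integrates it in time (piece P5b, space–time form):

* `tendsto_integral_spaceTime_axisTerm` — for `F : ℝ × ℝ³ → ℝ` continuous with compact support,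
  `∫∫ F(t,x) (2/ϱ)∂_ϱψ_ε(x) dx dt → 2c₂ ∫∫ F(t, (0,0,x₃)) dx₃ dt` as `ε → 0⁺` (Fubini, the slice
  limit, and dominated convergence in `t` with the uniform slice bound `M · 2c₂ · 2L`).

## References

* G. Seregin, Anal. Math. Phys. 10 (2020), Paper 46 = arXiv:2006.04140, proof of Lemma 2.2
  (arXiv p. 8), the axis term `4π₀ ∫ πη dx₃dt`. [Seregin2020]
* A. I. Nazarov, N. N. Uraltseva, St. Petersburg Math. J. 23 (2012) 93–115 = arXiv:1011.1888,
  §4, (4.3) and (4.5). [NazarovUraltseva2012]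
-/

-- the problem directory repeats the summit name (D-0017); core's `dupNamespace` linter fires
set_option linter.dupNamespace false

noncomputable section

open MeasureTheory Set Function Filter Topology TopologicalSpace Metric WithLp
open scoped NNReal ENNReal InnerProductSpace RealInnerProductSpace

namespace Summit.NavierStokesRegularity.NavierStokesRegularity.Theorems.AxisymmetricKatoGlobal.EulerScaling

open Literature.Analysis.FluidPDE Literature.Analysis.FluidPDE.Seregin2020

/-- **The axis term in space–time.** For `F : ℝ × ℝ³ → ℝ` continuous with compact support,
`∫∫ F(t, x) (2/ϱ) ∂_ϱψ_ε(x) dx dt → 2c₂ ∫∫ F(t, (0, 0, x₃)) dx₃ dt` (`2c₂ = 4π`) as `ε → 0⁺`,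
where `ψ_ε(x) = sT((2/ε)ϱ(x) - 1)` is the axis cut-off and `(2/ϱ)∂_ϱψ_ε = (2x'/|x'|²)·∇ψ_ε`:
Fubini, the slice limit `tendsto_integral_mul_axisDrift_axisCutoff`, and dominated convergence in
`t` (the slices are bounded by `M · 2c₂ · 2L` uniformly in `ε`). With `F = Φη` this is the axis
term `4π₀ ∫ πη dx₃ dt` of Seregin's displayed inequality.
[cite: Seregin2020, proof of Lemma 2.2 (arXiv p. 8), the axis term 4π₀∫πη dx₃dt; NazarovUraltseva2012 (4.5)] -/
theorem tendsto_integral_spaceTime_axisTerm : ∀ {F : ℝ × EuclideanSpace ℝ (Fin 3) → ℝ}, Continuous F →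
    HasCompactSupport F →
    Tendsto (fun ε : ℝ => ∫ z : ℝ × EuclideanSpace ℝ (Fin 3),
        F z * (2 / cylRadius z.2 * (deriv Real.smoothTransition (2 / ε * cylRadius z.2 - 1) * (2 / ε))))
      (𝓝[>] 0) (𝓝 (2 * radialConst₂ * ∫ p : ℝ × ℝ, F (p.1, meridianPoint (0, p.2)))) := by
  intro F hF hFc
  -- a ball containing the support, a bound of `F`
  obtain ⟨L, hL0, hL⟩ : ∃ L : ℝ, 0 < L ∧ tsupport F ⊆ closedBall (0 : ℝ × EuclideanSpace ℝ (Fin 3)) L := by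
    obtain ⟨R, hR⟩ := hFc.isCompact.isBounded.subset_closedBall 0
    exact ⟨max R 1, lt_of_lt_of_le one_pos (le_max_right _ _), hR.trans (closedBall_subset_closedBall (le_max_left _ _))⟩
  have hF0 : ∀ z : ℝ × EuclideanSpace ℝ (Fin 3), L < ‖z‖ → F z = 0 := fun z hz =>
    image_eq_zero_of_notMem_tsupport fun h => by
      have := hL h; rw [mem_closedBall, dist_zero_right] at this; linarith
  have hF0t : ∀ (t : ℝ) (x : EuclideanSpace ℝ (Fin 3)), L < |t| → F (t, x) = 0 := fun t x ht =>
    hF0 (t, x) (lt_of_lt_of_le ht (by simpa only [Real.norm_eq_abs] using norm_fst_le ((t, x) : ℝ × EuclideanSpace ℝ (Fin 3))))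
  have hF0x : ∀ (t : ℝ) (x : EuclideanSpace ℝ (Fin 3)), L < ‖x‖ → F (t, x) = 0 := fun t x hx =>
    hF0 (t, x) (lt_of_lt_of_le hx (norm_snd_le ((t, x) : ℝ × EuclideanSpace ℝ (Fin 3))))
  have hF02 : ∀ (t : ℝ) (x : EuclideanSpace ℝ (Fin 3)), L < |x 2| → F (t, x) = 0 := fun t x hx =>
    hF0x t x (lt_of_lt_of_le hx (Literature.Barriers.NavierStokesRegularity.abs_apply_two_le_norm x))
  obtain ⟨M, hM⟩ : ∃ M, ∀ z, |F z| ≤ M := by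
    obtain ⟨M, hM⟩ := hF.bounded_above_of_compact_support hFc
    exact ⟨M, fun z => by simpa [Real.norm_eq_abs] using hM z⟩
  have hM0 : 0 ≤ M := (abs_nonneg _).trans (hM 0)
  -- the slices
  have hmk : ∀ t : ℝ, Continuous fun x : EuclideanSpace ℝ (Fin 3) => ((t, x) : ℝ × EuclideanSpace ℝ (Fin 3)) :=
    fun t => continuous_const.prodMk continuous_id
  have hFt : ∀ t : ℝ, Continuous fun x : EuclideanSpace ℝ (Fin 3) => F (t, x) := fun t => hF.comp (hmk t)
  have hFtc : ∀ t : ℝ, HasCompactSupport fun x : EuclideanSpace ℝ (Fin 3) => F (t, x) := by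
    intro t
    refine HasCompactSupport.intro (isCompact_closedBall (0 : EuclideanSpace ℝ (Fin 3)) L) fun x hx => hF0x t x ?_
    rw [mem_closedBall, dist_zero_right, not_le] at hx
    exact hx
  -- the profile and the space–time integrand
  set k : ℝ → EuclideanSpace ℝ (Fin 3) → ℝ := fun ε x =>
    2 / cylRadius x * (deriv Real.smoothTransition (2 / ε * cylRadius x - 1) * (2 / ε)) with hk
  have hkm : ∀ ε, Measurable (k ε) := fun ε =>
    (measurable_const.div continuous_cylRadius.measurable).mul
      ((((Real.smoothTransition.contDiff (n := 1)).continuous_deriv le_rfl).measurable.comp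
        ((measurable_const.mul continuous_cylRadius.measurable).sub measurable_const)).mul measurable_const)
  set a : ℝ → ℝ → ℝ := fun ε t => ∫ x, F (t, x) * k ε x with ha
  set a₀ : ℝ → ℝ := fun t => 2 * radialConst₂ * ∫ s : ℝ, F (t, meridianPoint (0, s)) with ha₀
  -- (1) integrability of the space–time integrand and Fubini, for `ε > 0`
  have hG : ∀ ε, 0 < ε → Integrable (fun z : ℝ × EuclideanSpace ℝ (Fin 3) => F z * k ε z.2) ∧
      ∫ z : ℝ × EuclideanSpace ℝ (Fin 3), F z * k ε z.2 = ∫ t, a ε t := by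
    intro ε hε
    obtain ⟨hnn, -, -, -⟩ := axisCutoff_profile_props hε
    have hk0 : ∀ x, 0 ≤ k ε x := fun x => mul_nonneg (div_nonneg zero_le_two (cylRadius_nonneg x)) (hnn _)
    -- dominating product function
    set g : ℝ → ℝ := (Icc (-L) L).indicator fun _ => M with hg
    have hgi : Integrable g :=
      (integrableOn_const (C := M) (by exact measure_Icc_lt_top.ne)).integrable_indicator measurableSet_Icc
    obtain ⟨hdom, -⟩ := integral_axisDrift_axisCutoff_mul hε hgi
    set τ : ℝ → ℝ := (Icc (-L) L).indicator fun _ => (1 : ℝ) with hτ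
    have hτi : Integrable τ :=
      (integrableOn_const (C := (1 : ℝ)) (by exact measure_Icc_lt_top.ne)).integrable_indicator measurableSet_Icc
    have hprod : Integrable (fun z : ℝ × EuclideanSpace ℝ (Fin 3) => τ z.1 * (k ε z.2 * g (z.2 2))) := by
      have h := hτi.mul_prod hdom
      rw [← Measure.volume_eq_prod] at h
      exact h
    have hbound : ∀ z : ℝ × EuclideanSpace ℝ (Fin 3), ‖F z * k ε z.2‖ ≤ τ z.1 * (k ε z.2 * g (z.2 2)) := by
      intro z
      rw [Real.norm_eq_abs, abs_mul, abs_of_nonneg (hk0 _)]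
      by_cases ht : |z.1| ≤ L
      · by_cases hx : |z.2 2| ≤ L
        · rw [hτ, hg, Set.indicator_of_mem (mem_Icc.2 (abs_le.1 ht)), Set.indicator_of_mem (mem_Icc.2 (abs_le.1 hx)),
            one_mul, mul_comm (k ε z.2)]
          exact mul_le_mul_of_nonneg_right (hM z) (hk0 _)
        · have : F z = 0 := hF02 z.1 z.2 (not_le.1 hx)
          rw [this, abs_zero, zero_mul]
          exact mul_nonneg (by rw [hτ]; exact indicator_nonneg (fun _ _ => zero_le_one) _)
            (mul_nonneg (hk0 _) (by rw [hg]; exact indicator_nonneg (fun _ _ => hM0) _))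
      · have : F z = 0 := hF0t z.1 z.2 (not_le.1 ht)
        rw [this, abs_zero, zero_mul]
        exact mul_nonneg (by rw [hτ]; exact indicator_nonneg (fun _ _ => zero_le_one) _)
          (mul_nonneg (hk0 _) (by rw [hg]; exact indicator_nonneg (fun _ _ => hM0) _))
    have hmeas : AEStronglyMeasurable (fun z : ℝ × EuclideanSpace ℝ (Fin 3) => F z * k ε z.2) volume :=
      hF.aestronglyMeasurable.mul ((hkm ε).comp measurable_snd).aestronglyMeasurable
    have hint : Integrable (fun z : ℝ × EuclideanSpace ℝ (Fin 3) => F z * k ε z.2) :=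
      hprod.mono' hmeas (Eventually.of_forall hbound)
    refine ⟨hint, ?_⟩
    rw [Measure.volume_eq_prod]
    exact integral_prod _ ((Measure.volume_eq_prod (ℝ) (EuclideanSpace ℝ (Fin 3))) ▸ hint)
  -- (2) the slice limits and the uniform slice bound
  have hlim : ∀ t, Tendsto (fun ε => a ε t) (𝓝[>] 0) (𝓝 (a₀ t)) := fun t =>
    tendsto_integral_mul_axisDrift_axisCutoff (hFt t) (hFtc t)
  set B : ℝ → ℝ := (Icc (-L) L).indicator fun _ => M * (2 * radialConst₂ * (2 * L)) with hB
  have hBi : Integrable B :=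
    (integrableOn_const (C := M * (2 * radialConst₂ * (2 * L))) (by exact measure_Icc_lt_top.ne)).integrable_indicator
      measurableSet_Icc
  have hbd : ∀ ε, 0 < ε → ∀ t, ‖a ε t‖ ≤ B t := by
    intro ε hε t
    by_cases ht : |t| ≤ L
    · rw [hB, Set.indicator_of_mem (mem_Icc.2 (abs_le.1 ht)), Real.norm_eq_abs]
      exact (abs_integral_mul_axisDrift_axisCutoff_le (hFt t).aestronglyMeasurable (fun x => hM (t, x)) hL0.le
        (hF02 t) hε).2
    · have h0 : a ε t = 0 := by
        simp only [ha]
        refine integral_eq_zero_of_ae (Eventually.of_forall fun x => ?_)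
        simp [hF0t t x (not_le.1 ht)]
      rw [h0, norm_zero, hB]
      exact indicator_nonneg (fun _ _ => by have := radialConst₂_pos; positivity) _
  -- (3) dominated convergence in `t`
  have hev : ∀ᶠ ε in 𝓝[>] (0 : ℝ), 0 < ε := self_mem_nhdsWithin
  have hDCT : Tendsto (fun ε => ∫ t, a ε t) (𝓝[>] 0) (𝓝 (∫ t, a₀ t)) := by
    refine tendsto_integral_filter_of_dominated_convergence B ?_ ?_ hBi (Eventually.of_forall hlim)
    · filter_upwards [hev] with ε hε
      have h := (hG ε hε).1
      rw [Measure.volume_eq_prod] at h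
      exact h.aestronglyMeasurable.integral_prod_right'
    · filter_upwards [hev] with ε hε
      exact Eventually.of_forall (hbd ε hε)
  -- (4) the limit is the product integral
  have hH : Integrable (fun p : ℝ × ℝ => F (p.1, meridianPoint (0, p.2))) := by
    have hc : Continuous fun p : ℝ × ℝ => F (p.1, meridianPoint (0, p.2)) :=
      hF.comp (continuous_fst.prodMk ((contDiff_meridianPoint (n := (⊤ : ℕ∞))).continuous.comp
        (continuous_const.prodMk continuous_snd)))
    refine hc.integrable_of_hasCompactSupport ?_
    refine HasCompactSupport.intro (isCompact_closedBall (0 : ℝ × ℝ) L) fun p hp => hF0 _ ?_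
    rw [mem_closedBall, dist_zero_right, not_le] at hp
    have e : ‖((p.1, meridianPoint (0, p.2)) : ℝ × EuclideanSpace ℝ (Fin 3))‖ = ‖p‖ := by
      rw [Prod.norm_def, Prod.norm_def, norm_meridianPoint_zero, Real.norm_eq_abs, Real.norm_eq_abs]
    rwa [e]
  have hlimval : ∫ t, a₀ t = 2 * radialConst₂ * ∫ p : ℝ × ℝ, F (p.1, meridianPoint (0, p.2)) := by
    simp only [ha₀]
    rw [integral_const_mul, Measure.volume_eq_prod, integral_prod _ ((Measure.volume_eq_prod (ℝ) (ℝ)) ▸ hH)]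
  -- assemble
  rw [← hlimval]
  refine hDCT.congr' ?_
  filter_upwards [hev] with ε hε
  exact ((hG ε hε).2).symm

end Summit.NavierStokesRegularity.NavierStokesRegularity.Theorems.AxisymmetricKatoGlobal.EulerScaling

end
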